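import Literature.IUT.HodgeTheaters.GoodLocalFrobenioidOfGaloisDdash
import Literature.IUT.HodgeTheaters.GoodLocalFrobenioidOfGaloisBaseRam
import Literature.AnabelianGeometry.AbsoluteAnabelian.AbsTopIThm26vHolds
import Literature.AnabelianGeometry.AbsoluteAnabelian.GaloisSubextensionProofs
import HarnessLib

/-!
# «`Δ_v̲ ⊆ Π_v̲` is characteristic» ([AbsAnab] Lemma 1.3.8, FACT F-0007 `PreservesGeom`) AT THE INITIAL
# Θ-DATUM'S LOCAL GROUP `Π_v̲ := Π_{X̲→_v̲}`, modulo one [AbsTopI] Thm 2.6 (v) regime — proofs only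

S. Mochizuki, *The Absolute Anabelian Geometry of Hyperbolic Curves*, Galois Theory and Modular Forms, Kluwer
(2004) [AbsAnab], Lemma 1.3.8 p. 18: an isomorphism `α_X : Π_{(X₁)_{K₁}} ⥲ Π_{(X₂)_{K₂}}` of the arithmetic
fundamental groups of hyperbolic curves over finite extensions `Kᵢ` of `ℚ_{pᵢ}` "is necessarily compatible with
the quotients `Π_{(Xᵢ)_{Kᵢ}} ↠ G_{Kᵢ}`"; proof p. 19 l. 2: "This follows formally from Lemmas 1.1.4, 1.1.5."
[cite: MochizukiAbsAnab2004, Lemma 1.3.8 p.18].  abc-iut-L4-t4 typed the conclusion as the PREDICATE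
`FundamentalExtension.PreservesGeom α` (`AbsAnabFundamentalGroups.lean`; FACT-LIST F-0007, a parametrised schema
row whose universal closure is refuted, `not_forall_preservesGeom`).  CONE CONSUMER: abc-iut-L5's closers of
[IUTchI] Example 3.3 (iii) (a) and (c)–(d) p. 79 [claim: Mochizuki2012, status: disputed]
(`InitialThetaData.ddashFromD_goodLocalFrobenioid{OfEmb,,At}_of_forall_map_ker` / `…At_of_geomTFG`,
`GoodLocalFrobenioidOfGaloisDdash.lean`; `InitialThetaData.cdashFromF_goodLocalFrobenioidOfEmb`,
`GoodLocalFrobenioidOfGaloisBaseRam.lean`) bind F-0007 IN UNFOLDED SHAPE at the datum's local group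
`Π_v̲ := Π_{X̲→_v̲} = Π_{X̲→_K} ×_{G_F} Gal(k̄/k)` (`D.PiLoc D.PiXarrow (localToGF F k ι)`, [IUTchI] Def. 3.1 (e)(f)):
`hΔ : ∀ φ : Π_v̲ ≃ₜ* Π_v̲, Ker(Π_v̲ ↠ Gal(k̄/k)).map φ = Ker(Π_v̲ ↠ Gal(k̄/k))`.

THIS PROOF-ONLY FILE (no `def`, no `instance`, no named fact; witnesses built inside the proofs; pattern of
`InitialThetaDataLocalSlim.lean`, which did the same for F-0004 at `Π_v̲`) DERIVES `hΔ` from print's own regime input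
for Lemma 1.3.8 — [AbsAnab] Lemma 1.1.4 (ii) / [AbsTopI] Thm 2.6 (v), whose USE is the tree's kernel theorem
`FundamentalExtension.preservesGeom_of_coinvariantRankConstant` / `preservesGeom_of_starCondition`
(`AbsTopIThm26vHolds.lean`, over the PROVED `lemma114_ii_holds` / `thm26v_of_coinvariantRankConstant`):
* `isTopologicallyFinitelyGenerated_inf_deltaC` / `_ker_augLoc` — `Δ_v̲ := Ker(Π_{(−)_v̲} ↠ Γ) ≅ Π_{(−)} ∩ Δ_C`
  is topologically finitely generated as soon as `Δ_C` is ([AbsTopI] Prop 2.2 = FACT F-0240 `GeomTFG` for the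
  datum's `Π_{C_F} ↠ G_F`, ALREADY a binder of the (a) closer `…At_of_geomTFG`) and `Π_{(−)} ⊆ Π_{C_F}` is open
  (Def. 3.1 (f), input `hX`): tfg descends to an open subgroup (Schreier) and passes along `kerAugLocEquiv`;
* `forall_map_ker_augLoc_of_preservesGeom` — transport: `hΔ` from `PreservesGeom` for every self-isomorphism of
  ANY packaging `Ev` of `Π_v̲ ↠ Gal(k̄/k)` as an abc-iut-L4 `FundamentalExtension` (`e : Π_{Ev} ≅ Π_v̲`, `e(Δ_{Ev}) = Δ_v̲`);
  `…_of_coinvariantRankConstant` (FACT F-0001 BY NAME on the packaging) / `…_of_starCondition` (print p. 19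
  literally: splitting F-0011 `SplitsOverOpenSubgroup` + `Δ` tfg + condition (∗) F-0012 `StarCondition`, the
  latter supplied in print by Lemma 1.1.5);
* `exists_fundamentalExtension_PiLoc` — NON-VACUITY of the packaging WITH MLF BASE DATA: `Π_v̲ ↠ Gal(k̄/k)` IS
  an extension `1 → Δ_v̲ → Π_v̲ → G_k → 1` in abc-iut-L4's sense with `MLFBase` `K := k = K_v̲`,
  `G := Gal(k̄/k)` = Mathlib's absolute Galois group, `galIso = id`, `Δ_{Ev} ↦ Δ_v̲` identically; `Δ_{Ev}` tfg
  under F-0240 + `hX`; hence the ∀-packaging regime form `forall_map_ker_augLoc_of_regime`;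
* `forall_map_ker_augLoc_of_coinvariantRank` — **`hΔ` DERIVED** from {F-0240, `hX`, FACT F-0001
  `CoinvariantRankConstant` IN UNFOLDED SHAPE at `Π_v̲`: for every open `P ⊆ Π_v̲`, `δ¹_l(P) − δ¹_l(aug P)` does
  not depend on `l` ([AbsTopI] Thm 2.6 (ii) on open subgroups — print's weight input, [AbsAnab] Lemma 1.1.5)}:
  F-0007 at `Π_v̲` is ELIMINATED in favour of print's regime input, the (H1) currency the [IUTchII] §1 Tate-curve
  setting already uses (`ThetaSetting.deltaX_map_eq_ofDoubleUnderline_of_coinvariantRankConstant`);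
* the Ex. 3.3 (iii) closers RE-TARGETED: `ddashFromD_goodLocalFrobenioidOfEmb_of_coinvariantRank`,
  `ddashFromD_goodLocalFrobenioidAt_of_coinvariantRank` ((a): binders {F-0240, `hX`, density where `k` is
  abstract, F-0001 shape}) and `cdashFromF_goodLocalFrobenioidOfEmb_of_coinvariantRank` ((d): + `Δ_C` slim, F-0004).

HONEST FRAMING: [AbsAnab]/[AbsTopI] are refereed and undisputed; «`hΔ` at `Π_v̲` modulo a regime» is an instance
of OUR typed predicate at OUR typed object, not the printed lemma; the regime binder (F-0001 shape / F-0011 +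
F-0012) is an assumption label supplied in print by the geometry of the curve, never asserted here; no curve and no
initial Θ-datum is asserted to exist; nothing here bears on [IUTchIII] Cor. 3.12; no side taken; typed ≠ proved.
-/

noncomputable section

namespace Literature.IUT.HodgeTheaters

open Literature.AnabelianGeometry.AbsoluteAnabelian Topology

universe u v

/-! ### `Δ_v̲ ≅ Π_{(−)} ∩ Δ_C` is topologically finitely generated when `Δ_C` is and `Π_{(−)}` is open -/

section LocalTFG

variable {F : Type u} {K : Type v} {Fbar : Type} [Field F] [NumberField F] [Field K] [NumberField K]
  [Algebra F K] [Field Fbar] [Algebra F Fbar] [Algebra K Fbar]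
  {E : WeierstrassCurve F} [E.IsElliptic] {l : ℕ} {Pb : BadPlacePredicates K}
  (D : InitialThetaData F K Fbar E l Pb) (H : Subgroup D.PiC)
  {Γ : Type} [Group Γ] [TopologicalSpace Γ] (ρ : Γ →* (Fbar ≃ₐ[F] Fbar))

namespace InitialThetaData

/-- **`Π_{(−)} ∩ Δ_C` is topologically finitely generated** when `Δ_C` is ([AbsTopI] Prop 2.2 for `Π_{C_F} ↠ G_F`,
FACT F-0240 `GeomTFG`) and `Π_{(−)} ⊆ Π_{C_F}` is open: tfg descends to the OPEN subgroup `Π_{(−)} ∩ Δ_C` of the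
compact `Δ_C` (Schreier; `IsTopologicallyFinitelyGenerated.subgroup_isOpen`). [cite: MochizukiAbsTopI2012, Prop 2.2 p.18] -/
theorem isTopologicallyFinitelyGenerated_inf_deltaC (hΔ : IsTopologicallyFinitelyGenerated D.DeltaC)
    (hX : IsOpen (H : Set D.PiC)) : IsTopologicallyFinitelyGenerated (H ⊓ D.DeltaC : Subgroup D.PiC) := by
  haveI : CompactSpace D.DeltaC := isCompact_iff_compactSpace.mp D.geom.extF.isClosed_geom.isCompact
  have ho : IsOpen ((H.subgroupOf D.DeltaC : Subgroup D.DeltaC) : Set D.DeltaC) := by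
    rw [Subgroup.coe_subgroupOf]
    exact hX.preimage continuous_subtype_val
  have h1 : IsTopologicallyFinitelyGenerated (H.subgroupOf D.DeltaC) := hΔ.subgroup_isOpen _ ho
  have hmem : ∀ x : H.subgroupOf D.DeltaC, ((x : D.DeltaC) : D.PiC) ∈ H ⊓ D.DeltaC := fun x =>
    Subgroup.mem_inf.mpr ⟨Subgroup.mem_subgroupOf.mp x.2, (x : D.DeltaC).2⟩
  let f : (H.subgroupOf D.DeltaC) →ₜ* (H ⊓ D.DeltaC : Subgroup D.PiC) :=
    { toFun := fun x => ⟨((x : D.DeltaC) : D.PiC), hmem x⟩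
      map_one' := Subtype.ext rfl
      map_mul' := fun _ _ => Subtype.ext rfl
      continuous_toFun := (continuous_subtype_val.comp continuous_subtype_val).subtype_mk _ }
  have hf : Function.Surjective f := by
    rintro ⟨x, hx⟩
    obtain ⟨hxH, hxΔ⟩ := Subgroup.mem_inf.mp hx
    exact ⟨⟨⟨x, hxΔ⟩, Subgroup.mem_subgroupOf.mpr hxH⟩, rfl⟩
  exact h1.of_surjective f hf

variable [IsTopologicalGroup Γ]

/-- **`Δ_v̲ := Ker(Π_{(−)_v̲} ↠ Γ)` is topologically finitely generated** when `Δ_C` is and `Π_{(−)}` is open: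
abc-iut-L5-t2's `kerAugLocEquiv : Ker ≅ Π_{(−)} ∩ Δ_C` (the geometric group is unchanged by base change) has the
continuous inverse `x ↦ ((x, 1))`, a continuous surjection onto the kernel. [cite: MochizukiAbsTopI2012, Prop 2.2 p.18] -/
theorem isTopologicallyFinitelyGenerated_ker_augLoc (hΔ : IsTopologicallyFinitelyGenerated D.DeltaC)
    (hX : IsOpen (H : Set D.PiC)) : IsTopologicallyFinitelyGenerated (D.augLoc H ρ).ker := by
  have h := D.isTopologicallyFinitelyGenerated_inf_deltaC H hΔ hX
  have hsymm : Continuous (D.kerAugLocEquiv H ρ).symm := by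
    apply Continuous.subtype_mk
    apply Continuous.subtype_mk
    exact continuous_subtype_val.prodMk continuous_const
  let f : (H ⊓ D.DeltaC : Subgroup D.PiC) →ₜ* (D.augLoc H ρ).ker :=
    ⟨(D.kerAugLocEquiv H ρ).symm.toMonoidHom, hsymm⟩
  exact h.of_surjective f (D.kerAugLocEquiv H ρ).symm.surjective

end InitialThetaData

end LocalTFG

/-! ### `hΔ` for `Π_v̲` from [AbsAnab] Lemma 1.3.8 / a Thm 2.6 (v) regime on ANY packaging -/

section Packaging

variable {F : Type u} {K : Type v} {Fbar : Type} [Field F] [NumberField F] [Field K] [NumberField K]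
  [Algebra F K] [Field Fbar] [Algebra F Fbar] [Algebra K Fbar] [IsScalarTower F K Fbar] [Normal K Fbar]
  {E : WeierstrassCurve F} [E.IsElliptic] {l : ℕ} {Pb : BadPlacePredicates K}
  (D : InitialThetaData F K Fbar E l Pb) (k : Type) [Field k] [Algebra K k]

namespace InitialThetaData

/-- **Transport step** ([AbsAnab] Lemma 1.3.8 BY NAME ⇒ `hΔ`): for ANY packaging `Ev` of `Π_v̲ ↠ Gal(k̄/k)` as an
extension of profinite groups (`e : Π_{Ev} ≅ Π_v̲` with `e(Δ_{Ev}) = Ker(Π_v̲ ↠ Gal(k̄/k))`), if every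
self-isomorphism of `Π_{Ev}` satisfies `PreservesGeom`, then every bicontinuous automorphism of `Π_v̲` carries
`Δ_v̲ := Ker(Π_v̲ ↠ Gal(k̄/k))` onto itself. [cite: MochizukiAbsAnab2004, Lemma 1.3.8 p.18] -/
theorem forall_map_ker_augLoc_of_preservesGeom (ι : Fbar →ₐ[K] AlgebraicClosure k)
    (Ev : FundamentalExtension.{0}) (e : Ev.arith ≃ₜ* D.PiLoc D.PiXarrow (localToGF F k ι))
    (he : Ev.geom.map e.toMulEquiv.toMonoidHom = (D.augLoc D.PiXarrow (localToGF F k ι)).ker)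
    (hgeom : ∀ α : Ev.arith ≃ₜ* Ev.arith, FundamentalExtension.PreservesGeom α)
    (φ : D.PiLoc D.PiXarrow (localToGF F k ι) ≃ₜ* D.PiLoc D.PiXarrow (localToGF F k ι)) :
    (D.augLoc D.PiXarrow (localToGF F k ι)).ker.map φ.toMulEquiv.toMonoidHom =
      (D.augLoc D.PiXarrow (localToGF F k ι)).ker := by
  have h := hgeom (e.trans (φ.trans e.symm))
  unfold FundamentalExtension.PreservesGeom at h
  apply_fun Subgroup.map e.toMulEquiv.toMonoidHom at h
  rw [Subgroup.map_map] at h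
  rw [← he, Subgroup.map_map]
  convert h using 2
  refine MonoidHom.ext fun x => ?_
  change φ (e x) = e ((e.trans (φ.trans e.symm)) x)
  simp

/-- tfg of `Δ_{Ev}` for any packaging `Ev` of `Π_v̲ ↠ Gal(k̄/k)` (`e(Δ_{Ev}) = Δ_v̲`), from tfg of `Δ_C` (F-0240)
and openness of `Π_{X̲→_K}` (`hX`): `e⁻¹` restricts to a continuous surjection `Δ_v̲ ↠ Δ_{Ev}`.
[cite: MochizukiAbsTopI2012, Prop 2.2 p.18] -/
theorem isTopologicallyFinitelyGenerated_geom_of_packaging (ι : Fbar →ₐ[K] AlgebraicClosure k)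
    (hTFG : D.geom.extF.GeomTFG) (hX : IsOpen (D.PiXarrow : Set D.PiC))
    (Ev : FundamentalExtension.{0}) (e : Ev.arith ≃ₜ* D.PiLoc D.PiXarrow (localToGF F k ι))
    (he : Ev.geom.map e.toMulEquiv.toMonoidHom = (D.augLoc D.PiXarrow (localToGF F k ι)).ker) :
    IsTopologicallyFinitelyGenerated Ev.geom := by
  have hker := D.isTopologicallyFinitelyGenerated_ker_augLoc D.PiXarrow (localToGF F k ι) hTFG hX
  have hmem : ∀ x : (D.augLoc D.PiXarrow (localToGF F k ι)).ker, e.symm (x : _) ∈ Ev.geom := by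
    intro x
    have hx : (x : D.PiLoc D.PiXarrow (localToGF F k ι)) ∈ Ev.geom.map e.toMulEquiv.toMonoidHom := by
      rw [he]; exact x.2
    obtain ⟨y, hy, hyx⟩ := Subgroup.mem_map.mp hx
    rw [← hyx, show e.symm (e.toMulEquiv.toMonoidHom y) = y from e.symm_apply_apply y]
    exact hy
  let f : (D.augLoc D.PiXarrow (localToGF F k ι)).ker →ₜ* Ev.geom :=
    { toFun := fun x => ⟨e.symm (x : _), hmem x⟩
      map_one' := Subtype.ext (by simp)
      map_mul' := fun x y => Subtype.ext (by simp)
      continuous_toFun := ((map_continuous e.symm).comp continuous_subtype_val).subtype_mk _ }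
  have hf : Function.Surjective f := by
    rintro ⟨y, hy⟩
    have hy' : e y ∈ (D.augLoc D.PiXarrow (localToGF F k ι)).ker := by
      rw [← he]
      exact Subgroup.mem_map_of_mem _ hy
    exact ⟨⟨e y, hy'⟩, Subtype.ext (e.symm_apply_apply y)⟩
  exact hker.of_surjective f hf

/-- **`hΔ` from [AbsTopI] Thm 2.6 (v) in the regime `CoinvariantRankConstant`, BY NAME on any packaging**: if some
packaging `Ev` of `Π_v̲ ↠ Gal(k̄/k)` with MLF base data has `Δ_{Ev}` tfg and `CoinvariantRankConstant` (FACT F-0001),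
then every bicontinuous automorphism of `Π_v̲` preserves `Δ_v̲`. [cite: MochizukiAbsTopI2012, Thm 2.6 (v) p.22] -/
theorem forall_map_ker_augLoc_of_coinvariantRankConstant (ι : Fbar →ₐ[K] AlgebraicClosure k)
    (Ev : FundamentalExtension.{0}) (B : Ev.MLFBase) (e : Ev.arith ≃ₜ* D.PiLoc D.PiXarrow (localToGF F k ι))
    (he : Ev.geom.map e.toMulEquiv.toMonoidHom = (D.augLoc D.PiXarrow (localToGF F k ι)).ker)
    (hΔE : IsTopologicallyFinitelyGenerated Ev.geom) (hc : Ev.CoinvariantRankConstant)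
    (φ : D.PiLoc D.PiXarrow (localToGF F k ι) ≃ₜ* D.PiLoc D.PiXarrow (localToGF F k ι)) :
    (D.augLoc D.PiXarrow (localToGF F k ι)).ker.map φ.toMulEquiv.toMonoidHom =
      (D.augLoc D.PiXarrow (localToGF F k ι)).ker :=
  D.forall_map_ker_augLoc_of_preservesGeom k ι Ev e he
    (fun α => FundamentalExtension.preservesGeom_of_coinvariantRankConstant B B hΔE hc hΔE hc α) φ

/-- **`hΔ` from print's own inputs for Lemma 1.3.8, BY NAME on any packaging** ("follows formally from Lemmas
1.1.4, 1.1.5", p. 19): if some packaging `Ev` of `Π_v̲ ↠ Gal(k̄/k)` with MLF base data satisfies the hypotheses of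
[AbsAnab] Lemma 1.1.4 (ii) — splitting over an open subgroup of `G` (FACT F-0011), `Δ` tfg, condition (∗) (FACT
F-0012; print: Lemma 1.1.5) — then every automorphism of `Π_v̲` preserves `Δ_v̲`. [cite: MochizukiAbsAnab2004, Lemma 1.3.8 p.18] -/
theorem forall_map_ker_augLoc_of_starCondition (ι : Fbar →ₐ[K] AlgebraicClosure k)
    (Ev : FundamentalExtension.{0}) (B : Ev.MLFBase) (e : Ev.arith ≃ₜ* D.PiLoc D.PiXarrow (localToGF F k ι))
    (he : Ev.geom.map e.toMulEquiv.toMonoidHom = (D.augLoc D.PiXarrow (localToGF F k ι)).ker)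
    (hs : Ev.SplitsOverOpenSubgroup) (hΔE : IsTopologicallyFinitelyGenerated Ev.geom) (hstar : Ev.StarCondition)
    (φ : D.PiLoc D.PiXarrow (localToGF F k ι) ≃ₜ* D.PiLoc D.PiXarrow (localToGF F k ι)) :
    (D.augLoc D.PiXarrow (localToGF F k ι)).ker.map φ.toMulEquiv.toMonoidHom =
      (D.augLoc D.PiXarrow (localToGF F k ι)).ker :=
  D.forall_map_ker_augLoc_of_preservesGeom k ι Ev e he
    (fun α => FundamentalExtension.preservesGeom_of_starCondition B B hs hΔE hstar hs hΔE hstar α) φ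

end InitialThetaData

end Packaging

/-! ### The packaging of `Π_v̲ ↠ Gal(k̄/k)` WITH MLF base data; `hΔ` from the regime at `Π_v̲` -/

section Datum

variable {F : Type u} {K : Type v} {Fbar : Type} [Field F] [NumberField F] [Field K] [NumberField K]
  [Algebra F K] [Field Fbar] [Algebra F Fbar] [Algebra K Fbar] [IsScalarTower F K Fbar] [Normal K Fbar]
  {E : WeierstrassCurve F} [E.IsElliptic] {l : ℕ} {Pb : BadPlacePredicates K}
  (D : InitialThetaData F K Fbar E l Pb) (p : ℕ) [Fact p.Prime]
  (k : Type) [NontriviallyNormedField k] [NormedAlgebra ℚ_[p] k] [FiniteDimensional ℚ_[p] k] [Algebra K k]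

namespace InitialThetaData

include p in
/-- **NON-VACUITY: `Π_v̲ ↠ Gal(k̄/k)` packages as an extension of profinite groups WITH MLF BASE DATA** (`K_v̲ = k`
finite over `ℚ_p`, `Π_{X̲→_K}` open): `Ev := (Π_v̲, Gal(k̄/k), the projection)` (profinite by `compactSpace_PiLoc`,
surjective by `augLoc_PiXarrow_surjective`), `MLFBase` `K := k` with `galIso = id`, `e = id`, `e(Δ_{Ev}) = Δ_v̲`;
and `Δ_{Ev}` is topologically finitely generated as soon as `Δ_C` is (F-0240). [cite: MochizukiAbsAnab2004, §1.3 p.18] -/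
theorem exists_fundamentalExtension_PiLoc (ι : Fbar →ₐ[K] AlgebraicClosure k)
    (hX : IsOpen (D.PiXarrow : Set D.PiC)) :
    ∃ (Ev : FundamentalExtension.{0}) (_ : Ev.MLFBase)
      (e : Ev.arith ≃ₜ* D.PiLoc D.PiXarrow (localToGF F k ι)),
      Ev.geom.map e.toMulEquiv.toMonoidHom = (D.augLoc D.PiXarrow (localToGF F k ι)).ker ∧
        (D.geom.extF.GeomTFG → IsTopologicallyFinitelyGenerated Ev.geom) := by
  haveI := GaloisValDatum.charZero p k
  haveI : CompactSpace (D.PiLoc D.PiXarrow (localToGF F k ι)) :=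
    D.compactSpace_PiLoc D.PiXarrow (localToGF F k ι) hX (continuous_localToGF F k ι)
  let Ev : FundamentalExtension.{0} :=
    { arith := ProfiniteGrp.of (D.PiLoc D.PiXarrow (localToGF F k ι))
      gal := absoluteGaloisGrp k
      aug := ⟨D.augLoc D.PiXarrow (localToGF F k ι), D.continuous_augLoc D.PiXarrow (localToGF F k ι)⟩
      aug_surjective := D.augLoc_PiXarrow_surjective k ι }
  let B : Ev.MLFBase := { p := p, K := k, galIso := ContinuousMulEquiv.refl _ }
  have he : Ev.geom.map (ContinuousMulEquiv.refl _).toMulEquiv.toMonoidHom =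
      (D.augLoc D.PiXarrow (localToGF F k ι)).ker := Subgroup.map_id _
  refine ⟨Ev, B, ContinuousMulEquiv.refl _, he, fun hTFG => ?_⟩
  exact D.isTopologicallyFinitelyGenerated_ker_augLoc D.PiXarrow (localToGF F k ι) hTFG hX

include p in
/-- **`hΔ` DERIVED from one regime in ∀-packaging form**: if every packaging of `Π_v̲ ↠ Gal(k̄/k)` with MLF base
data and `e(Δ_{Ev}) = Δ_v̲` has `CoinvariantRankConstant` (FACT F-0001), then — `Δ_C` being tfg (F-0240) and
`Π_{X̲→_K}` open — every bicontinuous automorphism of `Π_v̲` preserves `Δ_v̲`; the packaging is supplied by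
`exists_fundamentalExtension_PiLoc`. [cite: MochizukiAbsTopI2012, Thm 2.6 (v) p.22] -/
theorem forall_map_ker_augLoc_of_regime (ι : Fbar →ₐ[K] AlgebraicClosure k)
    (hTFG : D.geom.extF.GeomTFG) (hX : IsOpen (D.PiXarrow : Set D.PiC))
    (hreg : ∀ (Ev : FundamentalExtension.{0}) (_ : Ev.MLFBase)
      (e : Ev.arith ≃ₜ* D.PiLoc D.PiXarrow (localToGF F k ι)),
      Ev.geom.map e.toMulEquiv.toMonoidHom = (D.augLoc D.PiXarrow (localToGF F k ι)).ker →
        Ev.CoinvariantRankConstant)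
    (φ : D.PiLoc D.PiXarrow (localToGF F k ι) ≃ₜ* D.PiLoc D.PiXarrow (localToGF F k ι)) :
    (D.augLoc D.PiXarrow (localToGF F k ι)).ker.map φ.toMulEquiv.toMonoidHom =
      (D.augLoc D.PiXarrow (localToGF F k ι)).ker := by
  obtain ⟨Ev, B, e, he, htfg⟩ := D.exists_fundamentalExtension_PiLoc p k ι hX
  exact D.forall_map_ker_augLoc_of_coinvariantRankConstant k ι Ev B e he (htfg hTFG) (hreg Ev B e he) φ

include p in
/-- **`hΔ` DERIVED — F-0007 at `Π_v̲` from F-0240 + `hX` + F-0001 IN UNFOLDED SHAPE at `Π_v̲`.**  If `Δ_C` is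
topologically finitely generated (FACT F-0240 `GeomTFG` for `Π_{C_F} ↠ G_F`), `Π_{X̲→_K}` is open (Def. 3.1 (f)), and
for every open subgroup `P ⊆ Π_v̲` the number `δ¹_l(P) − δ¹_l(aug P)` does not depend on the prime `l` (FACT F-0001
`CoinvariantRankConstant` for `Π_v̲ ↠ Gal(k̄/k)`; print: [AbsTopI] Thm 2.6 (ii) on open subgroups), then every
bicontinuous automorphism of `Π_v̲ := Π_{X̲→_v̲}` carries `Δ_v̲ = Ker(Π_v̲ ↠ Gal(k̄/k))` onto itself ([AbsTopI] Thm
2.6 (v): "the kernel of `Π ↠ G` may be characterized group-theoretically"). [cite: MochizukiAbsTopI2012, Thm 2.6 (v) p.22] -/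
theorem forall_map_ker_augLoc_of_coinvariantRank (ι : Fbar →ₐ[K] AlgebraicClosure k)
    (hTFG : D.geom.extF.GeomTFG) (hX : IsOpen (D.PiXarrow : Set D.PiC))
    (hc : ∀ P : Subgroup (D.PiLoc D.PiXarrow (localToGF F k ι)),
      IsOpen (P : Set (D.PiLoc D.PiXarrow (localToGF F k ι))) →
      ∀ (l₁ l₂ : ℕ) [Fact l₁.Prime] [Fact l₂.Prime],
        freeProlRank P l₁ - freeProlRank (P.map (D.augLoc D.PiXarrow (localToGF F k ι))) l₁ =
          freeProlRank P l₂ - freeProlRank (P.map (D.augLoc D.PiXarrow (localToGF F k ι))) l₂)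
    (φ : D.PiLoc D.PiXarrow (localToGF F k ι) ≃ₜ* D.PiLoc D.PiXarrow (localToGF F k ι)) :
    (D.augLoc D.PiXarrow (localToGF F k ι)).ker.map φ.toMulEquiv.toMonoidHom =
      (D.augLoc D.PiXarrow (localToGF F k ι)).ker := by
  haveI := GaloisValDatum.charZero p k
  haveI : CompactSpace (D.PiLoc D.PiXarrow (localToGF F k ι)) :=
    D.compactSpace_PiLoc D.PiXarrow (localToGF F k ι) hX (continuous_localToGF F k ι)
  let Ev : FundamentalExtension.{0} :=
    { arith := ProfiniteGrp.of (D.PiLoc D.PiXarrow (localToGF F k ι))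
      gal := absoluteGaloisGrp k
      aug := ⟨D.augLoc D.PiXarrow (localToGF F k ι), D.continuous_augLoc D.PiXarrow (localToGF F k ι)⟩
      aug_surjective := D.augLoc_PiXarrow_surjective k ι }
  let B : Ev.MLFBase := { p := p, K := k, galIso := ContinuousMulEquiv.refl _ }
  have htfg : IsTopologicallyFinitelyGenerated Ev.geom :=
    D.isTopologicallyFinitelyGenerated_ker_augLoc D.PiXarrow (localToGF F k ι) hTFG hX
  have hcE : Ev.CoinvariantRankConstant := fun P hP l₁ l₂ _ _ => hc P hP l₁ l₂
  exact FundamentalExtension.preservesGeom_of_coinvariantRankConstant B B htfg hcE htfg hcE φ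

end InitialThetaData

end Datum

/-! ### [IUTchI] Example 3.3 (iii) (a) and (d) for the Θ-datum with F-0007 replaced by the regime -/

section Cone

variable {F : Type u} {K : Type} {Fbar : Type} [Field F] [NumberField F] [Field K] [NumberField K]
  [Algebra F K] [Field Fbar] [Algebra F Fbar] [Algebra K Fbar] [IsScalarTower F K Fbar] [Normal K Fbar]
  {E : WeierstrassCurve F} [E.IsElliptic] {l : ℕ} {Pb : BadPlacePredicates K}
  (D : InitialThetaData F K Fbar E l Pb) (p : ℕ) [Fact p.Prime]
  (k : Type) [NontriviallyNormedField k] [CompleteSpace k] [IsUltrametricDist k] [NormedAlgebra ℚ_[p] k]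
  [FiniteDimensional ℚ_[p] k] [Algebra K k]

namespace InitialThetaData

/-- **[IUTchI] Ex. 3.3 (iii) (a) for the initial Θ-datum `D` at `v̲ ∈ V̲^good ∩ V̲^non`, `K_v̲ = k` (`K ⊆ k` dense),
along `ι : F̄ → k̄`**: `D⊢_v̲ ⊆ D_v̲` is reconstructible from `D_v̲ = 𝓑(Π_v̲)⁰` at `goodLocalFrobenioidOfEmb`, MODULO
F-0240 `GeomTFG` for `Π_{C_F} ↠ G_F` (also gives Galois-countability of `Π_{C_F}`, [IUTchI] Rmk 2.5.3 (ii)), the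
datum's openness `hX`, and F-0001 `CoinvariantRankConstant` in unfolded shape at `Π_v̲` — the [AbsAnab] Lemma 1.3.8
binder `hΔ` (F-0007 shape) of `ddashFromD_goodLocalFrobenioidOfEmb_of_forall_map_ker` is DISCHARGED by
`forall_map_ker_augLoc_of_coinvariantRank`. ([IUTchI] Ex 3.3 (iii) (a) p.79) [claim: Mochizuki2012, status: disputed] -/
theorem ddashFromD_goodLocalFrobenioidOfEmb_of_coinvariantRank (hTFG : D.geom.extF.GeomTFG)
    (ι : Fbar →ₐ[K] AlgebraicClosure k) (hX : IsOpen (D.PiXarrow : Set D.PiC))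
    (hd : DenseRange (algebraMap K k))
    (hc : ∀ P : Subgroup (D.PiLoc D.PiXarrow (localToGF F k ι)),
      IsOpen (P : Set (D.PiLoc D.PiXarrow (localToGF F k ι))) →
      ∀ (l₁ l₂ : ℕ) [Fact l₁.Prime] [Fact l₂.Prime],
        freeProlRank P l₁ - freeProlRank (P.map (D.augLoc D.PiXarrow (localToGF F k ι))) l₁ =
          freeProlRank P l₂ - freeProlRank (P.map (D.augLoc D.PiXarrow (localToGF F k ι))) l₂) :
    @GoodLocalFrobenioid.DdashFromD p k _ (GaloisValDatum.normVal k) (D.goodLocalFrobenioidOfEmb p k ι hX) :=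
  haveI := D.secondCountableTopology_PiC_of_geomTFG hTFG
  D.ddashFromD_goodLocalFrobenioidOfEmb_of_forall_map_ker p k ι hX hd
    (D.forall_map_ker_augLoc_of_coinvariantRank p k ι hTFG hX hc)

/-- **[IUTchI] Ex. 3.3 (iii) (d) (`C⊢_v̲` from `F̲_v̲`) for `D` at `v̲`, `K_v̲ = k`, along `ι`**, at `goodLocalFrobenioidOfEmb`:
abc-iut-L5-t16's closer `cdashFromF_goodLocalFrobenioidOfEmb` with its [AbsAnab] Lemma 1.3.8 binder `hΔ` (F-0007 shape)
DISCHARGED by the regime; binders {F-0240 `GeomTFG`, `hX`, density, `Δ_C` slim (F-0004, first conjunct), F-0001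
shape at `Π_v̲`}. ([IUTchI] Ex 3.3 (iii) (d) p.79) [claim: Mochizuki2012, status: disputed] -/
theorem cdashFromF_goodLocalFrobenioidOfEmb_of_coinvariantRank (hTFG : D.geom.extF.GeomTFG)
    (ι : Fbar →ₐ[K] AlgebraicClosure k) (hX : IsOpen (D.PiXarrow : Set D.PiC))
    (hd : DenseRange (algebraMap K k)) (hΔC : Literature.AlgebraicGeometry.Frobenioids.IsSlimGroup D.DeltaC)
    (hc : ∀ P : Subgroup (D.PiLoc D.PiXarrow (localToGF F k ι)),
      IsOpen (P : Set (D.PiLoc D.PiXarrow (localToGF F k ι))) →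
      ∀ (l₁ l₂ : ℕ) [Fact l₁.Prime] [Fact l₂.Prime],
        freeProlRank P l₁ - freeProlRank (P.map (D.augLoc D.PiXarrow (localToGF F k ι))) l₁ =
          freeProlRank P l₂ - freeProlRank (P.map (D.augLoc D.PiXarrow (localToGF F k ι))) l₂) :
    @GoodLocalFrobenioid.CdashFromF p k _ (GaloisValDatum.normVal k) (D.goodLocalFrobenioidOfEmb p k ι hX) :=
  haveI := D.secondCountableTopology_PiC_of_geomTFG hTFG
  D.cdashFromF_goodLocalFrobenioidOfEmb p k ι hX hd hΔC
    (D.forall_map_ker_augLoc_of_coinvariantRank p k ι hTFG hX hc)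

end InitialThetaData

end Cone

/-! ### (a) at an actual place `v̲ = w ∣ p` of `K` -/

section Place

open Literature.NumberTheory.NumberFields IsDedekindDomain NumberField

variable {F : Type u} {K : Type} {Fbar : Type} [Field F] [NumberField F] [Field K] [NumberField K]
  [Algebra F K] [Field Fbar] [Algebra F Fbar] [Algebra K Fbar] [IsScalarTower F K Fbar] [Normal K Fbar]
  {E : WeierstrassCurve F} [E.IsElliptic] {l : ℕ} {Pb : BadPlacePredicates K}
  (D : InitialThetaData F K Fbar E l Pb) (w : HeightOneSpectrum (𝓞 K)) (p : ℕ) [Fact p.Prime]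
  (hw : ((p : ℕ) : 𝓞 K) ∈ w.asIdeal)

namespace InitialThetaData

/-- **[IUTchI] Ex. 3.3 (iii) (a) for `D` AT THE FINITE PLACE `v̲ = w ∣ p` OF `K`** (`K_v̲ := K_w`, `Ω := K̄_w`,
`Π_v̲ := Π_{X̲→_K} ×_{G_K} G_w`, chosen embedding), MODULO EXACTLY: F-0240 `GeomTFG` for `Π_{C_F} ↠ G_F`, the datum's
openness `hX`, and F-0001 `CoinvariantRankConstant` in unfolded shape at `Π_v̲` — `ddashFromD_goodLocalFrobenioidAt_of_geomTFG`
with its [AbsAnab] Lemma 1.3.8 binder (F-0007 shape) REPLACED by print's regime input ([AbsTopI] Thm 2.6 (ii)).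
([IUTchI] Ex 3.3 (iii) (a) p.79) [claim: Mochizuki2012, status: disputed] -/
theorem ddashFromD_goodLocalFrobenioidAt_of_coinvariantRank (hTFG : D.geom.extF.GeomTFG)
    (hX : IsOpen (D.PiXarrow : Set D.PiC))
    (hc : letI : Algebra K (RescaledCompletion K p w hw) := inferInstanceAs (Algebra K (w.adicCompletion K))
      ∀ P : Subgroup (D.PiLoc D.PiXarrow (localToGF F (RescaledCompletion K p w hw)
          (localEmb (K := K) (Fbar := Fbar) (AlgebraicClosure (RescaledCompletion K p w hw))))),
      IsOpen (P : Set (D.PiLoc D.PiXarrow (localToGF F (RescaledCompletion K p w hw)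
          (localEmb (K := K) (Fbar := Fbar) (AlgebraicClosure (RescaledCompletion K p w hw)))))) →
      ∀ (l₁ l₂ : ℕ) [Fact l₁.Prime] [Fact l₂.Prime],
        freeProlRank P l₁ - freeProlRank (P.map (D.augLoc D.PiXarrow (localToGF F (RescaledCompletion K p w hw)
          (localEmb (K := K) (Fbar := Fbar) (AlgebraicClosure (RescaledCompletion K p w hw)))))) l₁ =
          freeProlRank P l₂ - freeProlRank (P.map (D.augLoc D.PiXarrow (localToGF F (RescaledCompletion K p w hw)
            (localEmb (K := K) (Fbar := Fbar) (AlgebraicClosure (RescaledCompletion K p w hw)))))) l₂) :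
    @GoodLocalFrobenioid.DdashFromD p (RescaledCompletion K p w hw) _
      (GaloisValDatum.normVal (RescaledCompletion K p w hw)) (D.goodLocalFrobenioidAt w p hw hX) := by
  letI : Algebra K (RescaledCompletion K p w hw) := inferInstanceAs (Algebra K (w.adicCompletion K))
  haveI := GaloisValDatum.finiteDimensional_rescaledCompletion K p w hw
  exact D.ddashFromD_goodLocalFrobenioidOfEmb_of_coinvariantRank p (RescaledCompletion K p w hw) hTFG _ hX
    (HeightOneSpectrum.denseRange_algebraMap K w) hc

end InitialThetaData

end Place

end Literature.IUT.HodgeTheaters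

end
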